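import Mathlib.Algebra.Order.Field.GeomSum
import Mathlib.Analysis.SpecificLimits.Basic
import Mathlib.Analysis.SpecialFunctions.Pow.Real
import Mathlib.Topology.Algebra.InfiniteSum.ENNReal
import Mathlib.Data.ENNReal.BigOperators

/-!
# Crux `PerpetualPump.AveragedTypeIBlowup` (stmt-NavierStokesRegularity-1835), line `Sketch`:
# stub `typeISumWeak` — the Type-I summation lemma with the weak ladder decay

This file proves the registered stub `stub_typeISumWeak` of the line skeleton
`Cruxes/AveragedTypeIBlowup/Lines/Sketch.lean`. It is the Type-I summation `stub_typeISum`
(file `…TypeISum.lean`; the present file is self-contained) with the decay hypothesis above the front weakened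
to the ladder rate of the line: the ratio `ρ` only satisfies `ρ (1+ε₀)^19 ≤ 1`, so the geometric
series above the front has ratio `r := (1+ε₀)ρ ≤ (1+ε₀)^{-18} ≤ (1+ε₀)^{-1}` and
`1/(1-r) ≤ (1+ε₀)/ε₀`; the bound becomes `20 C₁ (1+ε₀)^{n+2}/ε₀` (we prove `2 C₁ (1+ε₀)^{n+2}/ε₀`).

Proof (Mathlib only). With `q := 1 + ε₀`, `a_k := q^{3k/2} F_k = q^k (q^{k/2} F_k)`:
* as in `…TypeISum.lean`, the `ℤ`-indexed `ℝ≥0∞`-sum is the supremum of the real partial sums over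
  `m < i` (`Function.Injective.tsum_eq`, `ENNReal.tsum_eq_iSup_nat`, `ENNReal.ofReal_sum_of_nonneg`);
* low scales `m ≤ n+1`: `a_m ≤ C₁ q^m` and `∑_{m<n+2} q^m = (q^{n+2} - 1)/ε₀` (`geom_sum_eq`);
* high scales: `a_{n+j} ≤ C₁ q^n r^j ≤ C₁ q^n r^{j-2}` (`r ≤ 1`), and
  `∑_{m<i} r^m ≤ 1/(1-r) ≤ q/ε₀ ≤ q²/ε₀` (`geom_sum_Ico_le_of_lt_one`), so the high part is
  `≤ C₁ q^{n+2}/ε₀` as well.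

## References

* T. Tao, *Finite time blowup for an averaged three-dimensional Navier–Stokes equation*, J. Amer.
  Math. Soc. 29 (2016), 601–674, §4–§5 (context only; the lemma itself is elementary).
-/

noncomputable section

-- the summit namespace `…NavierStokesRegularity.NavierStokesRegularity…` is the tree convention
set_option linter.dupNamespace false

open Finset

open scoped ENNReal

namespace Summit.NavierStokesRegularity.NavierStokesRegularity.Theorems.PerpetualPumpAveragedTypeIBlowup

/-- **Exponent splitting.** For `q > 0`, `m : ℕ` and a real factor `x`,
`q^{3m/2} x = q^m · (q^{m/2} x)` (natural power times real power). [folklore] -/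
theorem typeISumWeak_rpow_mul {q : ℝ} (hq : 0 < q) (m : ℕ) (x : ℝ) :
    q ^ ((3 : ℝ) * m / 2) * x = q ^ m * (q ^ ((m : ℝ) / 2) * x) := by
  rw [← mul_assoc, ← Real.rpow_natCast, ← Real.rpow_add hq]
  congr 2
  ring

/-- **Low-scale partial sum.** If `(1+ε₀)^{k/2} F_k ≤ C₁` for `0 ≤ k ≤ n + 1`, then
`∑_{m<n+2} (1+ε₀)^{3m/2} F_m ≤ C₁ ∑_{m<n+2} (1+ε₀)^m = C₁ ((1+ε₀)^{n+2} - 1)/ε₀`. [folklore] -/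
theorem typeISumWeak_sum_low {ε₀ C₁ : ℝ} {F : ℤ → ℝ} {n : ℕ} (hε : 0 < ε₀)
    (hlow : ∀ k : ℤ, 0 ≤ k → k ≤ (n : ℤ) + 1 → (1 + ε₀) ^ ((k : ℝ) / 2) * F k ≤ C₁) :
    ∑ m ∈ range (n + 2), (1 + ε₀) ^ ((3 : ℝ) * m / 2) * F m ≤
      C₁ * (((1 + ε₀) ^ (n + 2) - 1) / ε₀) := by
  have hq : 0 < 1 + ε₀ := by linarith
  calc ∑ m ∈ range (n + 2), (1 + ε₀) ^ ((3 : ℝ) * m / 2) * F m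
      ≤ ∑ m ∈ range (n + 2), C₁ * (1 + ε₀) ^ m := by
        refine sum_le_sum fun m hm => ?_
        have hm' : m ≤ n + 1 := by have := mem_range.1 hm; omega
        rw [typeISumWeak_rpow_mul hq, mul_comm C₁]
        refine mul_le_mul_of_nonneg_left ?_ (pow_nonneg hq.le m)
        have h := hlow (m : ℤ) (Int.natCast_nonneg m) (by exact_mod_cast hm')
        simpa only [Int.cast_natCast] using h
    _ = C₁ * (((1 + ε₀) ^ (n + 2) - 1) / ε₀) := by
        rw [← mul_sum, geom_sum_eq (by linarith : (1 + ε₀ : ℝ) ≠ 1), add_sub_cancel_left]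

/-- **High-scale termwise bound, ratio form.** If `q^{(n+j)/2} F_{n+j} ≤ C₁ ρ^j` for `j ≥ 2`, then
for `j ≥ 2` the Type-I weighted term satisfies `q^{3(n+j)/2} F_{n+j} ≤ C₁ q^n (qρ)^j`. [folklore] -/
theorem typeISumWeak_term_high {q C₁ ρ : ℝ} {F : ℤ → ℝ} {n : ℕ} (hq : 0 < q)
    (hhigh : ∀ j : ℕ, 2 ≤ j → q ^ (((n : ℝ) + j) / 2) * F (n + j) ≤ C₁ * ρ ^ j)
    {j : ℕ} (hj : 2 ≤ j) :
    q ^ ((3 : ℝ) * ((n + j : ℕ) : ℝ) / 2) * F ((n + j : ℕ) : ℤ) ≤ C₁ * q ^ n * (q * ρ) ^ j := by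
  rw [typeISumWeak_rpow_mul hq]
  have h1 : q ^ (((n + j : ℕ) : ℝ) / 2) * F ((n + j : ℕ) : ℤ) ≤ C₁ * ρ ^ j := by
    have h := hhigh j hj
    push_cast
    exact h
  calc q ^ (n + j) * (q ^ (((n + j : ℕ) : ℝ) / 2) * F ((n + j : ℕ) : ℤ))
      ≤ q ^ (n + j) * (C₁ * ρ ^ j) := mul_le_mul_of_nonneg_left h1 (pow_nonneg hq.le _)
    _ = C₁ * q ^ n * (q * ρ) ^ j := by rw [pow_add, mul_pow]; ring

/-- **The ratio.** If `ρ ≥ 0` and `ρ (1+ε₀)^19 ≤ 1` (`ε₀ > 0`), then the ratio `r := (1+ε₀)ρ` of the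
geometric series above the front satisfies `0 ≤ r ≤ 1/(1+ε₀)`. [folklore] -/
theorem typeISumWeak_ratio {ε₀ ρ : ℝ} (hε : 0 < ε₀) (hρ : 0 ≤ ρ) (hρq : ρ * (1 + ε₀) ^ 19 ≤ 1) :
    0 ≤ (1 + ε₀) * ρ ∧ (1 + ε₀) * ρ ≤ 1 / (1 + ε₀) := by
  have hq : 1 ≤ 1 + ε₀ := by linarith
  refine ⟨mul_nonneg (by linarith) hρ, ?_⟩
  rw [le_div_iff₀ (by linarith : (0 : ℝ) < 1 + ε₀)]
  calc (1 + ε₀) * ρ * (1 + ε₀) = ρ * (1 + ε₀) ^ 2 := by ring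
    _ ≤ ρ * (1 + ε₀) ^ 19 := mul_le_mul_of_nonneg_left (pow_le_pow_right₀ hq (by norm_num)) hρ
    _ ≤ 1 := hρq

/-- **Finite geometric sums.** For `0 ≤ r < 1`, `∑_{m<i} r^m ≤ 1/(1-r)`. [folklore] -/
theorem typeISumWeak_geom_le {r : ℝ} (hr0 : 0 ≤ r) (hr1 : r < 1) (i : ℕ) :
    ∑ m ∈ range i, r ^ m ≤ 1 / (1 - r) := by
  have h := geom_sum_Ico_le_of_lt_one (m := 0) (n := i) hr0 hr1
  rwa [pow_zero, ← range_eq_Ico] at h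

/-- **The inverse spectral gap.** For `0 < ε₀` and `r ≤ 1/(1+ε₀)`:
`1/(1-r) ≤ (1+ε₀)/ε₀ ≤ (1+ε₀)²/ε₀`. [folklore] -/
theorem typeISumWeak_inv_gap {ε₀ r : ℝ} (hε : 0 < ε₀) (hr : r ≤ 1 / (1 + ε₀)) :
    1 / (1 - r) ≤ (1 + ε₀) ^ 2 / ε₀ := by
  have hq : 0 < 1 + ε₀ := by linarith
  have e : ε₀ / (1 + ε₀) = 1 - 1 / (1 + ε₀) := by
    field_simp
    ring
  have hden : ε₀ / (1 + ε₀) ≤ 1 - r := by rw [e]; linarith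
  calc 1 / (1 - r) ≤ 1 / (ε₀ / (1 + ε₀)) := one_div_le_one_div_of_le (div_pos hε hq) hden
    _ = (1 + ε₀) / ε₀ := one_div_div _ _
    _ ≤ (1 + ε₀) ^ 2 / ε₀ := div_le_div_of_nonneg_right (by nlinarith [sq_nonneg ε₀]) hε.le

/-- **High-scale partial sums (weak decay).** Under the ladder decay above the front,
`∑_{m<i} (1+ε₀)^{3(n+2+m)/2} F_{n+2+m} ≤ C₁ (1+ε₀)^n ∑_{m<i} r^m ≤ C₁ (1+ε₀)^n (1+ε₀)²/ε₀`,
`r = (1+ε₀)ρ`. [folklore] -/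
theorem typeISumWeak_sum_high {ε₀ C₁ ρ : ℝ} {F : ℤ → ℝ} {n : ℕ} (hε : 0 < ε₀) (hC : 0 ≤ C₁)
    (hρ : 0 ≤ ρ) (hρq : ρ * (1 + ε₀) ^ 19 ≤ 1)
    (hhigh : ∀ j : ℕ, 2 ≤ j → (1 + ε₀) ^ (((n : ℝ) + j) / 2) * F (n + j) ≤ C₁ * ρ ^ j) (i : ℕ) :
    ∑ m ∈ range i, (1 + ε₀) ^ ((3 : ℝ) * ((n + 2 + m : ℕ) : ℝ) / 2) * F ((n + 2 + m : ℕ) : ℤ) ≤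
      C₁ * (1 + ε₀) ^ (n + 2) / ε₀ := by
  have hq : 0 < 1 + ε₀ := by linarith
  obtain ⟨hr0, hr1⟩ := typeISumWeak_ratio hε hρ hρq
  have hrq : 1 / (1 + ε₀) < 1 := by rw [div_lt_one hq]; linarith
  have hr1' : (1 + ε₀) * ρ < 1 := hr1.trans_lt hrq
  have hA : 0 ≤ C₁ * (1 + ε₀) ^ n := mul_nonneg hC (pow_nonneg hq.le n)
  calc ∑ m ∈ range i, (1 + ε₀) ^ ((3 : ℝ) * ((n + 2 + m : ℕ) : ℝ) / 2) * F ((n + 2 + m : ℕ) : ℤ)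
      ≤ ∑ m ∈ range i, C₁ * (1 + ε₀) ^ n * ((1 + ε₀) * ρ) ^ m := by
        refine sum_le_sum fun m _ => ?_
        have h := typeISumWeak_term_high hq hhigh (j := m + 2) (by omega)
        rw [show n + 2 + m = n + (m + 2) by omega]
        calc _ ≤ _ := h
          _ ≤ C₁ * (1 + ε₀) ^ n * ((1 + ε₀) * ρ) ^ m :=
              mul_le_mul_of_nonneg_left (pow_le_pow_of_le_one hr0 hr1'.le (by omega)) hA
    _ = C₁ * (1 + ε₀) ^ n * ∑ m ∈ range i, ((1 + ε₀) * ρ) ^ m := by rw [mul_sum]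
    _ ≤ C₁ * (1 + ε₀) ^ n * (1 / (1 - (1 + ε₀) * ρ)) :=
        mul_le_mul_of_nonneg_left (typeISumWeak_geom_le hr0 hr1' i) hA
    _ ≤ C₁ * (1 + ε₀) ^ n * ((1 + ε₀) ^ 2 / ε₀) :=
        mul_le_mul_of_nonneg_left (typeISumWeak_inv_gap hε hr1) hA
    _ = C₁ * (1 + ε₀) ^ (n + 2) / ε₀ := by rw [pow_add]; ring

/-- **All partial sums (weak decay).** Combining `typeISumWeak_sum_low` and `typeISumWeak_sum_high`
(after enlarging the range to `n + 2 + i` and splitting it with `Finset.sum_range_add`):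
`∑_{m<i} (1+ε₀)^{3m/2} F_m ≤ 2 C₁ (1+ε₀)^{n+2}/ε₀`. [folklore] -/
theorem typeISumWeak_partial_le {ε₀ C₁ ρ : ℝ} {F : ℤ → ℝ} {n : ℕ} (hε : 0 < ε₀)
    (hC : 0 ≤ C₁) (hρ : 0 ≤ ρ) (hρq : ρ * (1 + ε₀) ^ 19 ≤ 1) (hF : ∀ k : ℤ, 0 ≤ F k)
    (hlow : ∀ k : ℤ, 0 ≤ k → k ≤ (n : ℤ) + 1 → (1 + ε₀) ^ ((k : ℝ) / 2) * F k ≤ C₁)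
    (hhigh : ∀ j : ℕ, 2 ≤ j → (1 + ε₀) ^ (((n : ℝ) + j) / 2) * F (n + j) ≤ C₁ * ρ ^ j) (i : ℕ) :
    ∑ m ∈ range i, (1 + ε₀) ^ ((3 : ℝ) * m / 2) * F m ≤ 2 * C₁ * (1 + ε₀) ^ (n + 2) / ε₀ := by
  have hq : 0 < 1 + ε₀ := by linarith
  have hnn : ∀ m ∈ range (n + 2 + i), m ∉ range i →
      0 ≤ (1 + ε₀) ^ ((3 : ℝ) * m / 2) * F m :=
    fun m _ _ => mul_nonneg (Real.rpow_nonneg hq.le _) (hF m)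
  calc ∑ m ∈ range i, (1 + ε₀) ^ ((3 : ℝ) * m / 2) * F m
      ≤ ∑ m ∈ range (n + 2 + i), (1 + ε₀) ^ ((3 : ℝ) * m / 2) * F m :=
        sum_le_sum_of_subset_of_nonneg (range_mono (by omega)) hnn
    _ = ∑ m ∈ range (n + 2), (1 + ε₀) ^ ((3 : ℝ) * m / 2) * F m +
          ∑ m ∈ range i, (1 + ε₀) ^ ((3 : ℝ) * ((n + 2 + m : ℕ) : ℝ) / 2) *
            F ((n + 2 + m : ℕ) : ℤ) :=
        sum_range_add _ _ _
    _ ≤ C₁ * (((1 + ε₀) ^ (n + 2) - 1) / ε₀) + C₁ * (1 + ε₀) ^ (n + 2) / ε₀ :=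
        add_le_add (typeISumWeak_sum_low hε hlow) (typeISumWeak_sum_high hε hC hρ hρq hhigh i)
    _ ≤ C₁ * ((1 + ε₀) ^ (n + 2) / ε₀) + C₁ * (1 + ε₀) ^ (n + 2) / ε₀ := by
        have h : ((1 + ε₀) ^ (n + 2) - 1) / ε₀ ≤ (1 + ε₀) ^ (n + 2) / ε₀ :=
          div_le_div_of_nonneg_right (by linarith) hε.le
        exact add_le_add (mul_le_mul_of_nonneg_left h hC) le_rfl
    _ = 2 * C₁ * (1 + ε₀) ^ (n + 2) / ε₀ := by ring

/-- **Stub `typeISumWeak`** (Mathlib-only). TYPE-I SUMMATION WITH THE WEAK LADDER DECAY: at a fixed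
time a `ℤ`-family of nonnegative band majorants that is critically bounded (`(1+ε₀)^{k/2}F_k ≤ C₁`)
up to one scale above the front `n`, vanishes below the datum scale and decays above the front with
a ratio `ρ`, `ρ(1+ε₀)^19 ≤ 1`, has Type-I-weighted sum
`Σ_k (1+ε₀)^{3k/2}F_k ≤ 20 C₁ (1+ε₀)^{n+2}/ε₀` in `ℝ≥0∞`. Proof: reduce the `ℤ`-sum to the supremum
of the `ℕ`-partial sums and apply `typeISumWeak_partial_le`. [folklore] -/
theorem stub_typeISumWeak :
    ∀ (ε₀ : ℝ) (F : ℤ → ℝ) (n : ℤ) (C₁ ρ : ℝ), 0 < ε₀ → ε₀ ≤ 1 → 0 ≤ C₁ → 0 < ρ → ρ * (1 + ε₀) ^ 19 ≤ 1 →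
      0 ≤ n → (∀ k : ℤ, 0 ≤ F k) → (∀ k : ℤ, k < 0 → F k = 0) →
      (∀ k : ℤ, 0 ≤ k → k ≤ n + 1 → (1 + ε₀) ^ ((k : ℝ) / 2) * F k ≤ C₁) →
      (∀ j : ℕ, 2 ≤ j → (1 + ε₀) ^ (((n : ℝ) + j) / 2) * F (n + j) ≤ C₁ * ρ ^ j) →
      ∑' k : ℤ, ENNReal.ofReal ((1 + ε₀) ^ ((3 : ℝ) * k / 2) * F k) ≤
        ENNReal.ofReal (20 * C₁ * (1 + ε₀) ^ ((n : ℝ) + 2) / ε₀) := by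
  intro ε₀ F n C₁ ρ hε _hε1 hC hρ hρq hn hF hF0 hlow hhigh
  obtain ⟨n, rfl⟩ := Int.eq_ofNat_of_zero_le hn
  simp only [Int.cast_natCast] at hhigh
  have hq : 0 < 1 + ε₀ := by linarith
  -- the summand vanishes off the range of `Nat.cast : ℕ → ℤ`
  have hsupp : Function.support (fun k : ℤ => ENNReal.ofReal ((1 + ε₀) ^ ((3 : ℝ) * k / 2) * F k))
      ⊆ Set.range (Nat.cast : ℕ → ℤ) := by
    intro k hk
    rw [Function.mem_support] at hk
    rcases lt_or_ge k 0 with h | h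
    · exact (hk (by simp [hF0 k h])).elim
    · exact ⟨k.toNat, Int.toNat_of_nonneg h⟩
  -- comparison of the real bounds `2 C₁ q^{n+2}/ε₀ ≤ 20 C₁ q^{n+2}/ε₀` (natural vs. real power)
  have hB : 2 * C₁ * (1 + ε₀) ^ (n + 2) / ε₀ ≤
      20 * C₁ * (1 + ε₀) ^ (((n : ℤ) : ℝ) + 2) / ε₀ := by
    rw [Int.cast_natCast, show (n : ℝ) + 2 = ((n + 2 : ℕ) : ℝ) by push_cast; ring,
      Real.rpow_natCast]
    have hX : 0 ≤ C₁ * (1 + ε₀) ^ (n + 2) := by positivity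
    have h20 : 2 * C₁ * (1 + ε₀) ^ (n + 2) ≤ 20 * C₁ * (1 + ε₀) ^ (n + 2) := by nlinarith
    exact div_le_div_of_nonneg_right h20 hε.le
  refine le_trans ?_ (ENNReal.ofReal_le_ofReal hB)
  calc ∑' k : ℤ, ENNReal.ofReal ((1 + ε₀) ^ ((3 : ℝ) * k / 2) * F k)
      = ∑' m : ℕ, ENNReal.ofReal ((1 + ε₀) ^ ((3 : ℝ) * ((m : ℤ) : ℝ) / 2) * F m) :=
        (Nat.cast_injective.tsum_eq hsupp).symm
    _ = ⨆ i : ℕ, ∑ m ∈ range i,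
          ENNReal.ofReal ((1 + ε₀) ^ ((3 : ℝ) * ((m : ℤ) : ℝ) / 2) * F m) :=
        ENNReal.tsum_eq_iSup_nat
    _ ≤ ENNReal.ofReal (2 * C₁ * (1 + ε₀) ^ (n + 2) / ε₀) := by
        refine iSup_le fun i => ?_
        calc ∑ m ∈ range i, ENNReal.ofReal ((1 + ε₀) ^ ((3 : ℝ) * ((m : ℤ) : ℝ) / 2) * F m)
            = ENNReal.ofReal
                (∑ m ∈ range i, (1 + ε₀) ^ ((3 : ℝ) * ((m : ℤ) : ℝ) / 2) * F m) :=
              (ENNReal.ofReal_sum_of_nonneg fun (m : ℕ) _ =>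
                mul_nonneg (Real.rpow_nonneg hq.le _) (hF m)).symm
          _ ≤ ENNReal.ofReal (2 * C₁ * (1 + ε₀) ^ (n + 2) / ε₀) := by
              refine ENNReal.ofReal_le_ofReal ?_
              simp only [Int.cast_natCast]
              exact typeISumWeak_partial_le hε hC hρ.le hρq hF hlow hhigh i

end Summit.NavierStokesRegularity.NavierStokesRegularity.Theorems.PerpetualPumpAveragedTypeIBlowup

end
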